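import Mathlib
import Summits.Ventures.PercRepro2.CoinChainXAHullSix

/-!
# The sixth corner of the single fibre — the `m⁻` gate
(blind cell PercRepro2, night-2 g31; proofs/NIGHT2-DARC.md §73.6)

On the three-vertex core `U = {m, j, j'}` (one fibre of sure-entered clusters `m, mj, mj', mjj'` with `d`-masses
`b, b₁, b₂, b₁₂`; the coin-entered clusters `j, j', jj'` with killed masses `K₁, K₂, K₁₂`, so `δ = XJ + YJ − XYJ`)
the admissible M-supported gates form the region of `hull_six`, and the sixth corner is the gate equal to `d` on
the three marked `m`-clusters with `d'({m}) = d({m,j})·d({m,j'})/d({m,j,j'})` (the lsm-tight unmarked value).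
Its (XA′) functional is `T_m − Λ·α/b₁₂` (`Λ = b·b₁₂ − b₁·b₂` the lsm slack of `d` on the fibre, `α` the coefficient
of the unmarked gate mass): scaled by `b₁₂`, `E' = b₁₂·T_open + α·b₁·b₂`, and
`t²·E' = L·s_x·s_y·XM·YM + L³·Λ² + L²·Λ·(XM·s_y + YM·s_x) + t²·{b₁₂·Px·Py·[a·(L − b₁ − b₂) + (a·b₁ − K₁·b) + (a·b₂ − K₂·b)]
+ b₁·b₂·Px·Py·(K₁ + K₂) + Λ·K₁·Py·(L − Px) + Λ·K₂·Px·(L − Py) + Λ·K₁₂·(Px·(L − Py) + Py·(L − Px))}` — eleven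
nonnegative products (exact identity, mining/night-2/g31/py/gen_mminus.py).  The two facts beyond the
closed-gate family are `K₁·b ≤ a·b₁` and `K₂·b ≤ a·b₂`: the coin-killed cluster `{j}` against the unmarked
sure-entered cluster `{m}` meets in the ideal and joins in `{m, j}` (`(K, B) → (K, B)`, `closed_gate_pw`).
-/

namespace Summit.Ventures.PercRepro2.Coin

section MMinusThree

variable {R : Type*} [Field R] [LinearOrder R] [IsStrictOrderedRing R]

set_option maxHeartbeats 4000000 in
/-- **The `m⁻` corner of the single fibre** (parts form): the affine functional of `cg_mgate_decomp` at the gate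
`(ω, rₓ, r_y, r₀) = (XYM, XM − XYM, YM − XYM, (XM − XYM)(YM − XYM)/XYM)`, scaled by `XYM` — the hypothesis `Hmm` of
`hull_six_mass`. -/
theorem cg_mminus_three (a δ u t XJ XU XM YJ YU YM XYM XYJ : R) (hδ : δ = XJ + YJ - XYJ)
    (ha : 0 ≤ a) (hu : 0 ≤ u) (ht : 0 ≤ t) (hXJ : 0 ≤ XJ) (hXU : 0 ≤ XU) (hXM : 0 ≤ XM)
    (hYJ : 0 ≤ YJ) (hYU : 0 ≤ YU) (hYM : 0 ≤ YM) (hXYM : 0 ≤ XYM) (hXYJ : 0 ≤ XYJ)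
    (hK1 : 0 ≤ XJ - XYJ) (hK2 : 0 ≤ YJ - XYJ)
    (hb : 0 ≤ t - XM - YM + XYM) (hb1 : 0 ≤ XM - XYM) (hb2 : 0 ≤ YM - XYM)
    (hXUu : 0 ≤ u - XU) (hYUu : 0 ≤ u - YU)
    (hMcMx : 0 ≤ XM * (a + δ + u) - (XJ + XU) * t) (hMcMy : 0 ≤ YM * (a + δ + u) - (YJ + YU) * t)
    (hMM : 0 ≤ XYM * t - XM * YM)
    (hK1b : 0 ≤ a * (XM - XYM) - (XJ - XYJ) * (t - XM - YM + XYM))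
    (hK2b : 0 ≤ a * (YM - XYM) - (YJ - XYJ) * (t - XM - YM + XYM)) :
    0 ≤ XYM * ((a * (a + δ + u + t) * (XJ + XU + XM) * (YJ + YU + YM) - (XJ * (a + δ + u + t) - δ * (XJ + XU + XM)) * (YM * (a + δ + u + t) - t * (YJ + YU + YM)) - (YJ * (a + δ + u + t) - δ * (YJ + YU + YM)) * (XM * (a + δ + u + t) - t * (XJ + XU + XM))) + ((a + δ + u + t) * ((a + δ + u + t) - (XJ + XU + XM)) * ((a + δ + u + t) - (YJ + YU + YM)) + (XJ * (a + δ + u + t) - δ * (XJ + XU + XM)) * ((a + δ + u + t) - (YJ + YU + YM)) + (YJ * (a + δ + u + t) - δ * (YJ + YU + YM)) * ((a + δ + u + t) - (XJ + XU + XM))) * XYM + (-(((a + δ + u + t) * (a + δ + u + t) * (YJ + YU + YM) + (a + δ + u + t) * ((a + δ + u + t) * (YU + YM) - (YJ + YU + YM) * (a + u + t))) - ((a + δ + u + t) * (XJ + XU + XM) * (YJ + YU + YM) + ((a + δ + u + t) * (XU + XM) - (XJ + XU + XM) * (a + u + t)) * (YJ + YU + YM) + ((a + δ + u + t) * (YU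 + YM) - (YJ + YU + YM) * (a + u + t)) * (XJ + XU + XM)))) * (XM - XYM) + (-(((a + δ + u + t) * (a + δ + u + t) * (XJ + XU + XM) + (a + δ + u + t) * ((a + δ + u + t) * (XU + XM) - (XJ + XU + XM) * (a + u + t))) - ((a + δ + u + t) * (XJ + XU + XM) * (YJ + YU + YM) + ((a + δ + u + t) * (XU + XM) - (XJ + XU + XM) * (a + u + t)) * (YJ + YU + YM) + ((a + δ + u + t) * (YU + YM) - (YJ + YU + YM) * (a + u + t)) * (XJ + XU + XM)))) * (YM - XYM)) + ((a + δ + u + t) * (XJ + XU + XM) * (YJ + YU + YM) + ((a + δ + u + t) * (XU + XM) - (XJ + XU + XM) * (a + u + t)) * (YJ + YU + YM) + ((a + δ + u + t) * (YU + YM) - (YJ + YU + YM) * (a + u + t)) * (XJ + XU + XM)) * ((XM - XYM) * (YM - XYM)) := by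
  subst hδ
  have hL : 0 ≤ a + (XJ + YJ - XYJ) + u + t := by linarith
  have hPx : 0 ≤ XJ + XU + XM := by linarith
  have hPy : 0 ≤ YJ + YU + YM := by linarith
  have hLPx : 0 ≤ (a + (XJ + YJ - XYJ) + u + t) - (XJ + XU + XM) := by linarith
  have hLPy : 0 ≤ (a + (XJ + YJ - XYJ) + u + t) - (YJ + YU + YM) := by linarith
  have hLb : 0 ≤ (a + (XJ + YJ - XYJ) + u + t) - (XM - XYM) - (YM - XYM) := by linarith
  have ht2 : 0 ≤ t * t := mul_nonneg ht ht
  rcases ht.lt_or_eq with htpos | ht0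
  · have H1 := mul_nonneg (mul_nonneg (mul_nonneg (mul_nonneg hL hMcMx) hMcMy) hXM) hYM
    have H2 := mul_nonneg (mul_nonneg (mul_nonneg hL hL) hL) (mul_nonneg hMM hMM)
    have H3 := mul_nonneg (mul_nonneg (mul_nonneg (mul_nonneg hL hL) hMM) hXM) hMcMy
    have H4 := mul_nonneg (mul_nonneg (mul_nonneg (mul_nonneg hL hL) hMM) hYM) hMcMx
    have H5 := mul_nonneg (mul_nonneg (mul_nonneg (mul_nonneg (mul_nonneg ht2 hXYM) hPx) hPy) ha) hLb
    have H6 := mul_nonneg (mul_nonneg (mul_nonneg (mul_nonneg ht2 hXYM) hPx) hPy) hK1b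
    have H7 := mul_nonneg (mul_nonneg (mul_nonneg (mul_nonneg ht2 hXYM) hPx) hPy) hK2b
    have H8 := mul_nonneg (mul_nonneg (mul_nonneg (mul_nonneg (mul_nonneg ht2 hb1) hb2) hPx) hPy) (add_nonneg hK1 hK2)
    have H9 := mul_nonneg (mul_nonneg (mul_nonneg (mul_nonneg ht2 hMM) hK1) hPy) hLPx
    have H10 := mul_nonneg (mul_nonneg (mul_nonneg (mul_nonneg ht2 hMM) hK2) hPx) hLPy
    have H11 := mul_nonneg (mul_nonneg (mul_nonneg ht2 hMM) hXYJ) (add_nonneg (mul_nonneg hPx hLPy) (mul_nonneg hPy hLPx))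
    have key : 0 ≤ (t * t) * (XYM * ((a * (a + (XJ + YJ - XYJ) + u + t) * (XJ + XU + XM) * (YJ + YU + YM) - (XJ * (a + (XJ + YJ - XYJ) + u + t) - (XJ + YJ - XYJ) * (XJ + XU + XM)) * (YM * (a + (XJ + YJ - XYJ) + u + t) - t * (YJ + YU + YM)) - (YJ * (a + (XJ + YJ - XYJ) + u + t) - (XJ + YJ - XYJ) * (YJ + YU + YM)) * (XM * (a + (XJ + YJ - XYJ) + u + t) - t * (XJ + XU + XM))) + ((a + (XJ + YJ - XYJ) + u + t) * ((a + (XJ + YJ - XYJ) + u + t) - (XJ + XU + XM)) * ((a + (XJ + YJ - XYJ) + u + t) - (YJ + YU + YM)) + (XJ * (a + (XJ + YJ - XYJ) + u + t) - (XJ + YJ - XYJ) * (XJ + XU + XM)) * ((a + (XJ + YJ - XYJ) + u + t) - (YJ + YU + YM)) + (YJ * (a + (XJ + YJ - XYJ) + u + t) - (XJ + YJ - XYJ) * (YJ + YU + YM)) * ((a + (XJ + YJ - XYJ) + u + t) - (XJ + XU + XM))) * XYM + (-(((a + (XJ + YJ - XYJ) + u + t) * (a + (XJ + YJ - XYJ)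 + u + t) * (YJ + YU + YM) + (a + (XJ + YJ - XYJ) + u + t) * ((a + (XJ + YJ - XYJ) + u + t) * (YU + YM) - (YJ + YU + YM) * (a + u + t))) - ((a + (XJ + YJ - XYJ) + u + t) * (XJ + XU + XM) * (YJ + YU + YM) + ((a + (XJ + YJ - XYJ) + u + t) * (XU + XM) - (XJ + XU + XM) * (a + u + t)) * (YJ + YU + YM) + ((a + (XJ + YJ - XYJ) + u + t) * (YU + YM) - (YJ + YU + YM) * (a + u + t)) * (XJ + XU + XM)))) * (XM - XYM) + (-(((a + (XJ + YJ - XYJ) + u + t) * (a + (XJ + YJ - XYJ) + u + t) * (XJ + XU + XM) + (a + (XJ + YJ - XYJ) + u + t) * ((a + (XJ + YJ - XYJ) + u + t) * (XU + XM) - (XJ + XU + XM) * (a + u + t))) - ((a + (XJ + YJ - XYJ) + u + t) * (XJ + XU + XM) * (YJ + YU + YM) + ((a + (XJ + YJ - XYJ) + u + t) * (XU + XM) - (XJ + XU + XM) * (a + u + t)) * (YJ + YU + YM) + ((a + (XJ + YJ - XYJ) + u + t) * (YU + YM) - (YJ + YU + YM) * (a + u + t)) * (XJ + XU + XM)))) *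 (YM - XYM)) + ((a + (XJ + YJ - XYJ) + u + t) * (XJ + XU + XM) * (YJ + YU + YM) + ((a + (XJ + YJ - XYJ) + u + t) * (XU + XM) - (XJ + XU + XM) * (a + u + t)) * (YJ + YU + YM) + ((a + (XJ + YJ - XYJ) + u + t) * (YU + YM) - (YJ + YU + YM) * (a + u + t)) * (XJ + XU + XM)) * ((XM - XYM) * (YM - XYM))) := by
      linear_combination H1 + H2 + H3 + H4 + H5 + H6 + H7 + H8 + H9 + H10 + H11
    exact (mul_nonneg_iff_of_pos_left (mul_pos htpos htpos)).mp key
  · have hXM0 : XM = 0 := by linarith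
    have hYM0 : YM = 0 := by linarith
    have hXYM0 : XYM = 0 := by linarith
    rw [← ht0, hXM0, hYM0, hXYM0]
    simp

end MMinusThree

end Summit.Ventures.PercRepro2.Coin
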